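import Summits.QuantumFields.YangMills.Theorems.BalabanUVNodesN19LawPriceUpper

/-!
# YM-DAG node N19 (= NE7 proper) — THE LAW-LEVEL PRICE, III: an explicit modulus of continuity of the law in the window data, and the uniform statement

Cell `pub-ymgap`, HUMAN RULING D-0062 (Track A), R141 (C) wider-strategy seat `pub-ymgap-dag-n19-e` (strategy s3 = ALTERNATIVE CURRENCY), generation
g17, module 5 (sibling of `…N19LawPriceUpper`, filed right before; 400-line rule).  Route `Summits/QuantumFields/YangMills/Theses/BalabanUVNodes.lean`
rev 25, cluster item K3⁷ «SpineGivenEndpointR13SepCoPH» (stmt-QuantumFields-20544, dag-lead WORDS-143); filed `--supports` that item `--as helper` (it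
proves no registered stub).  COUNT-NEUTRAL: elementary real analysis over Mathlib (`Real.log_le_rpow_div`, `Real.rpow_mul_natCast`) + the sibling's
`abs_integral_sub_integral_le_lipschitz_of_cgf_close` BY NAME; no scheme object, no Theses import; NOT a discharge claim.

THE RESULT.  The sibling's degree-`n` bound `K∕√n + G·(3A)ⁿ·n!·2εe^{l₀}` carries the polylogarithm `A = max(1, 2e·max(1, log⁺ε⁻¹)∕l₀)`; trading
`log ε⁻¹ ≤ 2n·ε^{−1∕(2n)}` (§1) gives ★★ `abs_integral_sub_integral_le_lipschitz_sqrt`: for `0 ≤ ε ≤ 1` and every `n ≥ 1`,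
`|∫ g dν − ∫ g dμ| ≤ K∕√n + G·(2e^{l₀}·n!·(3max(1, 4en∕l₀))ⁿ)·√ε` — an explicit MODULUS OF CONTINUITY of the law (bounded-Lipschitz test functions) in
the window datum `ε`; and ★★ `law_controlled_of_cgf_close`: ∀ `0 < l₀` ∀ `η > 0` ∃ `ε₁ > 0` such that ANY two laws on `[0,1]` with cgf's `ε`-close
on `|t| ≤ l₀`, `ε ≤ ε₁`, are `η`-close on every `1`-Lipschitz `g` with `|g| ≤ 1` on `[0,1]` — the positive counterpart of `…N19LawPrice`'s
`law_price_not_inverse_log` (by the sibling's family, for every fixed `C` the choice `ε₁ = e^{−C∕η}` fails for small `η`; the `ε₁` produced here is of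
order `e^{−c·η^{−2}·log(1∕η)}`, not optimised).

HONEST FRAMING (binding).  Elementary and [folklore]; NO consumer in the DAG today; nothing of Bałaban's is instantiated; NE7 ∕ NE7b ∕ NE7c NOT PRINTED,
NOT proved; N19 NOT discharged; count-neutral.  One finite `T⁴` programme at fixed `ε`; nothing continuum ∕ `ℝ⁴` ∕ OS ∕ mass-gap ∕ Clay.  0 `def` ∕ 0 `sorry`.
-/

noncomputable section

open Real Finset MeasureTheory ProbabilityTheory

namespace Summit.QuantumFields.YangMills.Theorems.BalabanUVNodesN19LawPriceModulus

open Summit.QuantumFields.YangMills.Theorems.BalabanUVNodesN19LawPriceUpper (abs_integral_sub_integral_le_lipschitz_of_cgf_close)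

/-! ## §1 The polylogarithm traded for a root; the explicit modulus; the uniform statement -/

/-- The polylogarithm traded for a root [folklore]: for `0 < ε ≤ 1` and `n ≥ 1`,
`max(1, 2e·max(1, log ε⁻¹)∕l₀)ⁿ·ε ≤ max(1, 4en∕l₀)ⁿ·√ε` (`log ε⁻¹ ≤ 2n·ε^{−1∕(2n)}`, Mathlib `Real.log_le_rpow_div`). -/
theorem max_pow_mul_le_sqrt {ε l₀ : ℝ} (hl₀ : 0 < l₀) (hε : 0 < ε) (hε1 : ε ≤ 1) {n : ℕ} (hn : 1 ≤ n) :
    (max 1 (2 * Real.exp 1 * max 1 (Real.posLog ε⁻¹) / l₀)) ^ n * ε ≤ (max 1 (4 * Real.exp 1 * n / l₀)) ^ n * Real.sqrt ε := by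
  have hnr : (0 : ℝ) < n := by exact_mod_cast hn
  have hinv1 : 1 ≤ ε⁻¹ := one_le_inv_iff₀.2 ⟨hε, hε1⟩
  set r : ℝ := 1 / (2 * n) with hr
  have hr0 : 0 < r := by positivity
  set q : ℝ := ε⁻¹ ^ r with hq
  have hq1 : 1 ≤ q := Real.one_le_rpow hinv1 hr0.le
  have hq0 : 0 < q := one_pos.trans_le hq1
  -- `max(1, L) ≤ 2n·q`
  have hn1r : (1 : ℝ) ≤ n := by exact_mod_cast hn
  have hL : max 1 (Real.posLog ε⁻¹) ≤ 2 * n * q := by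
    refine max_le (by nlinarith [mul_nonneg (sub_nonneg.2 hn1r) (sub_nonneg.2 hq1)]) ?_
    rw [Real.posLog_eq_log (by rwa [abs_of_pos (inv_pos.2 hε)])]
    calc Real.log ε⁻¹ ≤ ε⁻¹ ^ r / r := Real.log_le_rpow_div (inv_pos.2 hε).le hr0
      _ = 2 * n * q := by rw [hq, hr]; field_simp
  -- `A ≤ max(1, 4en∕l₀)·q`
  have hA : max 1 (2 * Real.exp 1 * max 1 (Real.posLog ε⁻¹) / l₀) ≤ max 1 (4 * Real.exp 1 * n / l₀) * q := by
    refine max_le ?_ ?_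
    · calc (1 : ℝ) = 1 * 1 := (mul_one _).symm
        _ ≤ max 1 (4 * Real.exp 1 * n / l₀) * q := mul_le_mul (le_max_left _ _) hq1 zero_le_one (by positivity)
    · calc 2 * Real.exp 1 * max 1 (Real.posLog ε⁻¹) / l₀ ≤ 2 * Real.exp 1 * (2 * n * q) / l₀ := by gcongr
        _ = 4 * Real.exp 1 * n / l₀ * q := by ring
        _ ≤ max 1 (4 * Real.exp 1 * n / l₀) * q := mul_le_mul_of_nonneg_right (le_max_right _ _) hq0.le
  -- `qⁿ = ε^{−1∕2}` and `ε·ε^{−1∕2} = √ε`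
  have hqn : q ^ n * ε = Real.sqrt ε := by
    rw [hq, ← Real.rpow_mul_natCast (inv_pos.2 hε).le, hr, show 1 / (2 * (n : ℝ)) * n = 1 / 2 by field_simp,
      Real.inv_rpow hε.le, Real.sqrt_eq_rpow, inv_mul_eq_div]
    rw [div_eq_iff (Real.rpow_pos_of_pos hε _).ne', ← Real.rpow_add hε]
    norm_num
  calc (max 1 (2 * Real.exp 1 * max 1 (Real.posLog ε⁻¹) / l₀)) ^ n * ε
      ≤ (max 1 (4 * Real.exp 1 * n / l₀) * q) ^ n * ε :=
        mul_le_mul_of_nonneg_right (pow_le_pow_left₀ (by positivity) hA n) hε.le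
    _ = (max 1 (4 * Real.exp 1 * n / l₀)) ^ n * (q ^ n * ε) := by rw [mul_pow]; ring
    _ = (max 1 (4 * Real.exp 1 * n / l₀)) ^ n * Real.sqrt ε := by rw [hqn]

section Modulus

variable {μ ν : Measure ℝ} [IsProbabilityMeasure μ] [IsProbabilityMeasure ν]

/-- **★★ EXPLICIT MODULUS.**  Laws `μ, ν` on `[0,1]`, cgf's `ε`-close on `|t| ≤ l₀` with `0 ≤ ε ≤ 1`, `g` `K`-Lipschitz with `|g| ≤ G` on `[0,1]`:
for every `n ≥ 1`, `|∫ g dν − ∫ g dμ| ≤ K∕√n + G·(2e^{l₀}·n!·(3·max(1, 4en∕l₀))ⁿ)·√ε`. [folklore] -/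
theorem abs_integral_sub_integral_le_lipschitz_sqrt (hμ : μ (Set.Icc 0 1)ᶜ = 0) (hν : ν (Set.Icc 0 1)ᶜ = 0)
    {ε l₀ : ℝ} (hl₀ : 0 < l₀) (hε0 : 0 ≤ ε) (hε1 : ε ≤ 1) (hε : ∀ t : ℝ, |t| ≤ l₀ → |cgf id ν t - cgf id μ t| ≤ ε)
    {g : ℝ → ℝ} {K : NNReal} (hg : LipschitzWith K g) {G : ℝ} (hG : ∀ x ∈ Set.Icc (0 : ℝ) 1, |g x| ≤ G) {n : ℕ} (hn : 1 ≤ n) :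
    |∫ x, g x ∂ν - ∫ x, g x ∂μ| ≤
      K / Real.sqrt n + G * (2 * Real.exp l₀ * n.factorial * (3 * max 1 (4 * Real.exp 1 * n / l₀)) ^ n) * Real.sqrt ε := by
  have hG0 : 0 ≤ G := (abs_nonneg _).trans (hG 0 (by simp))
  refine (abs_integral_sub_integral_le_lipschitz_of_cgf_close hμ hν hl₀ hε0 hε hg hG hn).trans (add_le_add le_rfl ?_)
  rcases eq_or_lt_of_le hε0 with h | h
  · rw [← h]
    simp
  · have key := max_pow_mul_le_sqrt hl₀ h hε1 hn
    calc G * (3 * max 1 (2 * Real.exp 1 * max 1 (Real.posLog ε⁻¹) / l₀)) ^ n * (n.factorial * (2 * ε * Real.exp l₀))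
        = G * (2 * Real.exp l₀ * n.factorial * 3 ^ n) *
            ((max 1 (2 * Real.exp 1 * max 1 (Real.posLog ε⁻¹) / l₀)) ^ n * ε) := by rw [mul_pow]; ring
      _ ≤ G * (2 * Real.exp l₀ * n.factorial * 3 ^ n) * ((max 1 (4 * Real.exp 1 * n / l₀)) ^ n * Real.sqrt ε) :=
          mul_le_mul_of_nonneg_left key (by positivity)
      _ = G * (2 * Real.exp l₀ * n.factorial * (3 * max 1 (4 * Real.exp 1 * n / l₀)) ^ n) * Real.sqrt ε := by
          rw [mul_pow]; ring

/-- **★★ WINDOW MATCHING CONTROLS THE LAW, UNIFORMLY (the positive side of the sibling's `law_price_not_inverse_log`).**  For every window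
`0 < l₀` and every `η > 0` there is `ε₁ > 0` (depending on `l₀, η` only) such that ANY two probability laws on `[0,1]` whose cgf's are `ε`-close on
`|t| ≤ l₀` with `0 ≤ ε ≤ ε₁` are `η`-close on every `1`-Lipschitz `g` with `|g| ≤ 1` on `[0,1]`: `|∫ g dν − ∫ g dμ| ≤ η`.  So N19's currency does carry
the LAW (with the continuum law of p504707 ∕ p505344: a genuine, if logarithmic-type, modulus); the sibling shows the modulus cannot be `≤ C∕log ε⁻¹`.
[folklore] -/
theorem law_controlled_of_cgf_close {l₀ : ℝ} (hl₀ : 0 < l₀) {η : ℝ} (hη : 0 < η) :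
    ∃ ε₁ : ℝ, 0 < ε₁ ∧ ∀ (μ ν : Measure ℝ) [IsProbabilityMeasure μ] [IsProbabilityMeasure ν],
      μ (Set.Icc 0 1)ᶜ = 0 → ν (Set.Icc 0 1)ᶜ = 0 → ∀ ε : ℝ, 0 ≤ ε → ε ≤ ε₁ →
        (∀ t : ℝ, |t| ≤ l₀ → |cgf id ν t - cgf id μ t| ≤ ε) →
        ∀ g : ℝ → ℝ, LipschitzWith 1 g → (∀ x ∈ Set.Icc (0 : ℝ) 1, |g x| ≤ 1) →
          |∫ x, g x ∂ν - ∫ x, g x ∂μ| ≤ η := by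
  -- a degree `n` with `1∕√n ≤ η∕2`
  obtain ⟨n, hn⟩ := exists_nat_gt (4 / η ^ 2)
  have hn4 : 4 / η ^ 2 < n := hn
  have hnr : (0 : ℝ) < n := lt_trans (by positivity) hn4
  have hn1 : 1 ≤ n := by exact_mod_cast hnr
  have hsq : 1 / Real.sqrt n ≤ η / 2 := by
    rw [div_le_div_iff₀ (Real.sqrt_pos.2 hnr) two_pos, one_mul]
    have h2 : (2 / η) ^ 2 ≤ n := by rw [div_pow]; norm_num; exact hn4.le
    calc (2 : ℝ) = η * (2 / η) := by field_simp
      _ ≤ η * Real.sqrt n := by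
          refine mul_le_mul_of_nonneg_left ?_ hη.le
          rw [show 2 / η = Real.sqrt ((2 / η) ^ 2) by rw [Real.sqrt_sq (by positivity)]]
          exact Real.sqrt_le_sqrt h2
  set C : ℝ := 2 * Real.exp l₀ * n.factorial * (3 * max 1 (4 * Real.exp 1 * n / l₀)) ^ n with hC
  have hC0 : 0 < C := by positivity
  refine ⟨min 1 ((η / (2 * C)) ^ 2), lt_min one_pos (by positivity), ?_⟩
  intro μ ν _ _ hμ hν ε hε0 hε1 hε g hg hG
  have hε1' : ε ≤ 1 := hε1.trans (min_le_left _ _)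
  have hεC : Real.sqrt ε ≤ η / (2 * C) := by
    rw [← Real.sqrt_sq (by positivity : 0 ≤ η / (2 * C))]
    exact Real.sqrt_le_sqrt (hε1.trans (min_le_right _ _))
  have h := abs_integral_sub_integral_le_lipschitz_sqrt hμ hν hl₀ hε0 hε1' hε hg hG hn1
  rw [NNReal.coe_one] at h
  calc |∫ x, g x ∂ν - ∫ x, g x ∂μ| ≤ 1 / Real.sqrt n + 1 * C * Real.sqrt ε := h
    _ ≤ η / 2 + 1 * C * (η / (2 * C)) := add_le_add hsq (mul_le_mul_of_nonneg_left hεC (by positivity))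
    _ = η := by field_simp; ring

end Modulus

end Summit.QuantumFields.YangMills.Theorems.BalabanUVNodesN19LawPriceModulus

end
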